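import Literature.Topology.FourManifolds.SurfaceGroupRelatorCircuit
import Mathlib.Data.Finsupp.Basic
import HarnessLib

/-!
# The Cayley complex of the surface group: edge paths and traversal chains

Topic `Literature/Topology/FourManifolds`.  Book-keeping for pillar **(B)** (planar counting,
Zieschang–Vogt–Coldewey Thm. 5.4.2 / Cor. 5.4.3) of the algebraic proof of Nielsen's theorem
(`SurfaceGroupNielsenSetup.lean`).  We replace the planarity of the Cayley complex of
`S_g = ⟨a, b ∣ r_g⟩` by a winding `2`-chain count; this first file sets up the `1`-chains.

* Vertices of the Cayley graph `Γ` are the elements of `S_g`; the directed edge `(v, s)` goes from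
  `v` to `v · s`.  Reading a letter `ℓ = s^{±1}` at a vertex `u` traverses the edge `edgeOf u ℓ`
  forwards (`ℓ = s`) or backwards (`ℓ = s⁻¹`); after `k` letters of `w` we stand at
  `vtx v w k = v · (w.take k)`.
* The **traversal chain** `trav v w : Edge g →₀ ℤ` of a word `w` read from `v` is the signed sum
  of the edges it traverses.  It is additive under concatenation (`trav_append`), invariant under
  free reduction (`trav_eq_of_red`), hence factors through the free group (`travF`, `travF_mk`,
  `travF_mul`, `travF_inv`), is insensitive to conjugation of relators
  (`travF_conj_of_proj_eq_one`) and sends a signed product of conjugates of the relator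
  `conjProd L` to the corresponding signed sum of **face boundaries** `faceB F = trav F r_g`
  (`travF_conjProd`), whose coefficients form the finitely supported `2`-chain `chainOf L` of
  total mass `signSum L` (`sum_chainOf`).
* Pointwise evaluation: `trav v w` vanishes off the traversed edges
  (`trav_apply_eq_zero_of_forall_ne`) and takes the value `±1` on an edge traversed exactly once
  (`trav_apply_edge_of_injective`).

## References

* H. Zieschang, E. Vogt, H.-D. Coldewey, *Surfaces and Planar Discontinuous Groups*, LNM 835,
  Springer (1980), §5.4 (Thm. 5.4.2, Cor. 5.4.3). [ZieschangVogtColdewey1980]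
-/

noncomputable section

namespace Literature.Topology.FourManifolds

open Literature.GroupTheory.CombinatorialGroupTheory List

namespace SurfaceGroup

variable {g : ℕ}

/-! ## Letters, their values and their edges -/

/-- The image of the generator `s` in `S_g` (a vertex step of the Cayley graph). [folklore] -/
def gen (s : surfaceGen g) : SurfaceGroup g := proj g (FreeGroup.of s)

/-- The value in `S_g` of a signed letter `ℓ = s^{±1}`. [folklore] -/
def lval (ℓ : surfaceGen g × Bool) : SurfaceGroup g := proj g (sgen ℓ.1 ℓ.2)

/-- The formal inverse of a signed letter. [folklore] -/
def linv (ℓ : surfaceGen g × Bool) : surfaceGen g × Bool := (ℓ.1, !ℓ.2)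

/-- Directed edges of the Cayley graph: `(v, s)` goes from `v` to `v · s`. [folklore] -/
abbrev Edge (g : ℕ) : Type := SurfaceGroup g × surfaceGen g

/-- The edge along which the letter `ℓ` leaves the vertex `u`: the edge `(u, s)` (forwards) if
`ℓ = s`, the edge `(u s⁻¹, s)` (backwards) if `ℓ = s⁻¹`. [folklore] -/
def edgeOf (u : SurfaceGroup g) (ℓ : surfaceGen g × Bool) : Edge g :=
  (if ℓ.2 then u else u * lval ℓ, ℓ.1)

/-- `lval` of a positive letter. [folklore] -/
@[simp] theorem lval_true (s : surfaceGen g) : lval (s, true) = gen s := rfl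

/-- `lval` of a negative letter. [folklore] -/
@[simp] theorem lval_false (s : surfaceGen g) : lval (s, false) = (gen s)⁻¹ := by
  simp [lval, gen, sgen_false]

/-- The inverse letter has the inverse value. [folklore] -/
@[simp] theorem lval_linv (ℓ : surfaceGen g × Bool) : lval (linv ℓ) = (lval ℓ)⁻¹ := by
  obtain ⟨s, _ | _⟩ := ℓ <;> simp [linv]

/-- `linv` is an involution. [folklore] -/
@[simp] theorem linv_linv (ℓ : surfaceGen g × Bool) : linv (linv ℓ) = ℓ := by
  obtain ⟨s, b⟩ := ℓ; simp [linv]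

/-- The symbol of the inverse letter. [folklore] -/
@[simp] theorem linv_fst (ℓ : surfaceGen g × Bool) : (linv ℓ).1 = ℓ.1 := rfl

/-- The sign of the inverse letter. [folklore] -/
@[simp] theorem linv_snd (ℓ : surfaceGen g × Bool) : (linv ℓ).2 = !ℓ.2 := rfl

/-- `linv` on a pair. [folklore] -/
theorem linv_mk (s : surfaceGen g) (b : Bool) : linv (s, b) = (s, !b) := rfl

/-- `linv` is injective. [folklore] -/
theorem linv_injective : Function.Injective (linv (g := g)) := by
  intro a b h
  rw [← linv_linv a, h, linv_linv]

/-- A letter is never its own inverse. [folklore] -/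
theorem linv_ne_self (ℓ : surfaceGen g × Bool) : linv ℓ ≠ ℓ := by
  obtain ⟨s, _ | _⟩ := ℓ <;> simp [linv]

/-- The signs of a letter and of its inverse cancel. [folklore] -/
theorem bsign_bnot_add_bsign (b : Bool) : bsign (!b) + bsign b = 0 := by
  cases b <;> simp [bsign]

/-- The value of the empty word. [folklore] -/
@[simp] theorem proj_mk_nil : proj g (FreeGroup.mk []) = 1 := map_one (proj g)

/-- The value of a word with a letter in front. [folklore] -/
theorem proj_mk_cons (ℓ : surfaceGen g × Bool) (w : List (surfaceGen g × Bool)) :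
    proj g (FreeGroup.mk (ℓ :: w)) = lval ℓ * proj g (FreeGroup.mk w) := by
  rw [mk_cons_eq_sgen_mul, map_mul, lval]

/-- The value of a concatenation. [folklore] -/
theorem proj_mk_append (w₁ w₂ : List (surfaceGen g × Bool)) :
    proj g (FreeGroup.mk (w₁ ++ w₂)) = proj g (FreeGroup.mk w₁) * proj g (FreeGroup.mk w₂) := by
  rw [← FreeGroup.mul_mk, map_mul]

/-- The value of a one-letter word. [folklore] -/
@[simp] theorem proj_mk_singleton (ℓ : surfaceGen g × Bool) :
    proj g (FreeGroup.mk [ℓ]) = lval ℓ := by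
  rw [proj_mk_cons, proj_mk_nil, mul_one]

/-- The relator is trivial in `S_g`. [folklore] -/
@[simp] theorem proj_surfaceRelator : proj g (surfaceRelator g) = 1 := mk_surfaceRelator

/-- The symbol of `edgeOf`. [folklore] -/
@[simp] theorem edgeOf_snd (u : SurfaceGroup g) (ℓ : surfaceGen g × Bool) : (edgeOf u ℓ).2 = ℓ.1 := rfl

/-- `edgeOf` of a positive letter. [folklore] -/
@[simp] theorem edgeOf_true (u : SurfaceGroup g) (s : surfaceGen g) : edgeOf u (s, true) = (u, s) := by
  simp [edgeOf]

/-- `edgeOf` of a negative letter. [folklore] -/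
@[simp] theorem edgeOf_false (u : SurfaceGroup g) (s : surfaceGen g) :
    edgeOf u (s, false) = (u * (gen s)⁻¹, s) := by
  simp [edgeOf]

/-- Reading `ℓ` from `u` and reading `ℓ⁻¹` back from the endpoint traverse the same edge.
[folklore] -/
theorem edgeOf_mul_lval_linv (u : SurfaceGroup g) (ℓ : surfaceGen g × Bool) :
    edgeOf (u * lval ℓ) (linv ℓ) = edgeOf u ℓ := by
  obtain ⟨s, _ | _⟩ := ℓ <;> simp [linv, mul_assoc]

/-- **The two ends of an edge**: two (vertex, out-letter) pairs with the same edge are equal or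
are the two ends of that edge read in opposite directions. [folklore] -/
theorem edgeOf_eq_edgeOf_iff (u v : SurfaceGroup g) (μ ℓ : surfaceGen g × Bool) :
    edgeOf u μ = edgeOf v ℓ ↔ (u = v ∧ μ = ℓ) ∨ (u = v * lval ℓ ∧ μ = linv ℓ) := by
  obtain ⟨s, b⟩ := μ; obtain ⟨t, c⟩ := ℓ
  by_cases hst : s = t
  · subst hst
    cases b <;> cases c <;> simp [linv_mk, mul_inv_eq_iff_eq_mul]
  · constructor
    · intro h
      exact absurd (congrArg Prod.snd h) hst
    · rintro (⟨_, h⟩ | ⟨_, h⟩)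
      · exact absurd (congrArg Prod.fst h) hst
      · exact absurd (congrArg Prod.fst h) hst

/-! ## Vertices along a path -/

/-- The vertex reached from `v` after reading `k` letters of `w` (saturating at the endpoint).
[folklore] -/
def vtx (v : SurfaceGroup g) (w : List (surfaceGen g × Bool)) (k : ℕ) : SurfaceGroup g :=
  v * proj g (FreeGroup.mk (w.take k))

/-- Unfolding `vtx`. [folklore] -/
theorem vtx_def (v : SurfaceGroup g) (w : List (surfaceGen g × Bool)) (k : ℕ) :
    vtx v w k = v * proj g (FreeGroup.mk (w.take k)) := rfl

/-- The starting vertex. [folklore] -/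
@[simp] theorem vtx_zero (v : SurfaceGroup g) (w : List (surfaceGen g × Bool)) : vtx v w 0 = v := by
  simp [vtx]

/-- One more letter. [folklore] -/
theorem vtx_succ (v : SurfaceGroup g) (w : List (surfaceGen g × Bool)) {k : ℕ} (hk : k < w.length) :
    vtx v w (k + 1) = vtx v w k * lval w[k] := by
  rw [vtx, vtx, take_succ_eq_append_getElem hk, proj_mk_append, proj_mk_singleton, mul_assoc]

/-- Shifting the base point along the first letter. [folklore] -/
theorem vtx_cons_succ (v : SurfaceGroup g) (ℓ : surfaceGen g × Bool) (w : List (surfaceGen g × Bool))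
    (k : ℕ) : vtx v (ℓ :: w) (k + 1) = vtx (v * lval ℓ) w k := by
  rw [vtx, vtx, take_succ_cons, proj_mk_cons, mul_assoc]

/-- Past the end the vertex is the endpoint. [folklore] -/
theorem vtx_of_length_le (v : SurfaceGroup g) (w : List (surfaceGen g × Bool)) {k : ℕ}
    (hk : w.length ≤ k) : vtx v w k = v * proj g (FreeGroup.mk w) := by
  rw [vtx, take_of_length_le hk]

/-- The endpoint. [folklore] -/
@[simp] theorem vtx_length (v : SurfaceGroup g) (w : List (surfaceGen g × Bool)) :
    vtx v w w.length = v * proj g (FreeGroup.mk w) :=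
  vtx_of_length_le v w le_rfl

/-- Vertices of a concatenation, first part. [folklore] -/
theorem vtx_append_left (v : SurfaceGroup g) (w₁ w₂ : List (surfaceGen g × Bool)) {k : ℕ}
    (hk : k ≤ w₁.length) : vtx v (w₁ ++ w₂) k = vtx v w₁ k := by
  rw [vtx, vtx, take_append_of_le_length hk]

/-- Vertices of a concatenation, second part. [folklore] -/
theorem vtx_append_right (v : SurfaceGroup g) (w₁ w₂ : List (surfaceGen g × Bool)) (k : ℕ) :
    vtx v (w₁ ++ w₂) (w₁.length + k) = vtx (v * proj g (FreeGroup.mk w₁)) w₂ k := by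
  rw [vtx, vtx, take_length_add_append, proj_mk_append, mul_assoc]

/-- Translating the base point translates every vertex. [folklore] -/
theorem vtx_mul (a v : SurfaceGroup g) (w : List (surfaceGen g × Bool)) (k : ℕ) :
    vtx (a * v) w k = a * vtx v w k := by
  rw [vtx, vtx, mul_assoc]

/-! ## Traversal chains -/

/-- **Traversal chain** of the word `w` read from the vertex `v`: the signed sum of the directed
edges it traverses (`+1` for a generator read forwards, `-1` for an inverse generator, which
traverses its edge backwards). [cite: ZieschangVogtColdewey1980, §5.4] -/
def trav : SurfaceGroup g → List (surfaceGen g × Bool) → (Edge g →₀ ℤ)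
  | _, [] => 0
  | v, ℓ :: w => Finsupp.single (edgeOf v ℓ) (bsign ℓ.2) + trav (v * lval ℓ) w

/-- `trav` of the empty word. [folklore] -/
@[simp] theorem trav_nil (v : SurfaceGroup g) : trav v [] = 0 := rfl

/-- `trav` of a cons. [folklore] -/
theorem trav_cons (v : SurfaceGroup g) (ℓ : surfaceGen g × Bool) (w : List (surfaceGen g × Bool)) :
    trav v (ℓ :: w) = Finsupp.single (edgeOf v ℓ) (bsign ℓ.2) + trav (v * lval ℓ) w := rfl

/-- **Additivity under concatenation.** [folklore] -/
theorem trav_append (v : SurfaceGroup g) (w₁ w₂ : List (surfaceGen g × Bool)) :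
    trav v (w₁ ++ w₂) = trav v w₁ + trav (v * proj g (FreeGroup.mk w₁)) w₂ := by
  induction w₁ generalizing v with
  | nil => simp
  | cons ℓ w₁ ih => rw [cons_append, trav_cons, trav_cons, ih, proj_mk_cons, mul_assoc, add_assoc]

/-- A cancelling pair of letters traverses an edge back and forth: no contribution. [folklore] -/
theorem trav_cons_cons_not (v : SurfaceGroup g) (s : surfaceGen g) (b : Bool)
    (w : List (surfaceGen g × Bool)) : trav v ((s, b) :: (s, !b) :: w) = trav v w := by
  have h1 : edgeOf (v * lval (s, b)) (s, !b) = edgeOf v (s, b) := edgeOf_mul_lval_linv v (s, b)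
  have h2 : v * lval (s, b) * lval (s, !b) = v := by
    rw [← linv_mk, lval_linv, mul_inv_cancel_right]
  rw [trav_cons, trav_cons, h1, h2, show ((s, !b) : surfaceGen g × Bool).2 = !b from rfl,
    ← add_assoc, ← Finsupp.single_add, add_comm (bsign b), bsign_bnot_add_bsign, Finsupp.single_zero,
    zero_add]

/-- **Invariance under a reduction step.** [folklore] -/
theorem trav_eq_of_step {w w' : List (surfaceGen g × Bool)} (h : FreeGroup.Red.Step w w')
    (v : SurfaceGroup g) : trav v w = trav v w' := by
  induction h with
  | not => rw [trav_append, trav_append, trav_cons_cons_not]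

/-- **Invariance under free reduction.** [folklore] -/
theorem trav_eq_of_red {w w' : List (surfaceGen g × Bool)} (h : FreeGroup.Red w w')
    (v : SurfaceGroup g) : trav v w = trav v w' := by
  induction h with
  | refl => rfl
  | tail _ hst ih => rw [ih, trav_eq_of_step hst]

/-- The traversal chain of the reduced word. [folklore] -/
theorem trav_reduce (v : SurfaceGroup g) (w : List (surfaceGen g × Bool)) :
    trav v (FreeGroup.reduce w) = trav v w :=
  (trav_eq_of_red FreeGroup.reduce.red v).symm

/-- **Traversal chain of a free-group element** (through its reduced word). [folklore] -/
def travF (v : SurfaceGroup g) (x : FreeGroup (surfaceGen g)) : Edge g →₀ ℤ := trav v x.toWord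

/-- `travF` on `mk`. [folklore] -/
@[simp] theorem travF_mk (v : SurfaceGroup g) (w : List (surfaceGen g × Bool)) :
    travF v (FreeGroup.mk w) = trav v w := by
  rw [travF, FreeGroup.toWord_mk, trav_reduce]

/-- `travF` of `1`. [folklore] -/
@[simp] theorem travF_one (v : SurfaceGroup g) : travF v 1 = 0 := by
  rw [travF, FreeGroup.toWord_one]; rfl

/-- **Multiplicativity**: a product is read as the first factor followed by the second factor from
the endpoint of the first. [folklore] -/
theorem travF_mul (v : SurfaceGroup g) (x y : FreeGroup (surfaceGen g)) :
    travF v (x * y) = travF v x + travF (v * proj g x) y := by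
  have hx := FreeGroup.mk_toWord (x := x)
  have hy := FreeGroup.mk_toWord (x := y)
  calc travF v (x * y) = travF v (FreeGroup.mk (x.toWord ++ y.toWord)) := by
        rw [← FreeGroup.mul_mk, hx, hy]
    _ = travF v x + travF (v * proj g x) y := by
        rw [travF_mk, trav_append, hx]; rfl

/-- The inverse is read backwards from the endpoint. [folklore] -/
theorem travF_inv (v : SurfaceGroup g) (x : FreeGroup (surfaceGen g)) :
    travF v x⁻¹ = -travF (v * (proj g x)⁻¹) x := by
  have h := travF_mul v x⁻¹ x
  rw [inv_mul_cancel, travF_one, map_inv] at h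
  exact eq_neg_of_add_eq_zero_left h.symm

/-- **Conjugating a closed path** only moves its base point. [folklore] -/
theorem travF_conj_of_proj_eq_one (v : SurfaceGroup g) (c x : FreeGroup (surfaceGen g))
    (hx : proj g x = 1) : travF v (c * x * c⁻¹) = travF (v * proj g c) x := by
  rw [travF_mul, travF_mul, travF_inv, map_mul, hx, mul_one, mul_inv_cancel_right]
  abel

/-! ## Faces and signed products of conjugates of the relator -/

/-- **Boundary of the face `F`**: the traversal chain of the relator word `r_g` read from the
vertex `F` (faces of the Cayley complex are indexed by their base vertex).
[cite: ZieschangVogtColdewey1980, §5.4] -/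
def faceB (F : SurfaceGroup g) : Edge g →₀ ℤ := trav F (surfaceWordStd g)

/-- The relator is read as a face boundary. [folklore] -/
@[simp] theorem travF_surfaceRelator (v : SurfaceGroup g) : travF v (surfaceRelator g) = faceB v := by
  rw [← mk_surfaceWordStd, travF_mk, faceB]

/-- A signed relator is read as a signed face boundary. [folklore] -/
theorem travF_surfaceRelator_zpow (v : SurfaceGroup g) (b : Bool) :
    travF v (surfaceRelator g ^ bsign b) = bsign b • faceB v := by
  cases b
  · rw [show bsign false = -1 from rfl, zpow_neg, zpow_one, travF_inv, proj_surfaceRelator, inv_one,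
      mul_one, travF_surfaceRelator, neg_one_zsmul]
  · rw [show bsign true = 1 from rfl, zpow_one, travF_surfaceRelator, one_zsmul]

/-- **A signed product of conjugates of the relator is read as the signed sum of the face
boundaries at the conjugators.** [cite: ZieschangVogtColdewey1980, §5.4] -/
theorem travF_conjProd (L : List (FreeGroup (surfaceGen g) × Bool)) :
    travF 1 (conjProd L) = (L.map fun p => bsign p.2 • faceB (proj g p.1)).sum := by
  induction L with
  | nil => rw [map_nil, sum_nil, show conjProd ([] : List (FreeGroup (surfaceGen g) × Bool)) = 1 from rfl,
      travF_one]
  | cons p L ih =>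
    have hker : proj g (p.1 * surfaceRelator g ^ bsign p.2 * p.1⁻¹) = 1 := by
      rw [map_mul, map_mul, map_zpow, proj_surfaceRelator, one_zpow, mul_one, map_inv, mul_inv_cancel]
    rw [conjProd_cons, travF_mul, hker, mul_one, ih, travF_conj_of_proj_eq_one _ _ _ (by
      rw [map_zpow, proj_surfaceRelator, one_zpow]), one_mul, travF_surfaceRelator_zpow, map_cons,
      sum_cons]

/-- **The `2`-chain of a signed product of conjugates**: the face at `Kⱼ` with multiplicity `εⱼ`.
[cite: ZieschangVogtColdewey1980, §5.4] -/
def chainOf (L : List (FreeGroup (surfaceGen g) × Bool)) : SurfaceGroup g →₀ ℤ :=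
  (L.map fun p => Finsupp.single (proj g p.1) (bsign p.2)).sum

/-- `chainOf` of the empty list. [folklore] -/
@[simp] theorem chainOf_nil : chainOf ([] : List (FreeGroup (surfaceGen g) × Bool)) = 0 := rfl

/-- `chainOf` of a cons. [folklore] -/
theorem chainOf_cons (p : FreeGroup (surfaceGen g) × Bool) (L : List (FreeGroup (surfaceGen g) × Bool)) :
    chainOf (p :: L) = Finsupp.single (proj g p.1) (bsign p.2) + chainOf L := rfl

/-- **The total mass of the `2`-chain is the signed count.** [folklore] -/
theorem sum_chainOf (L : List (FreeGroup (surfaceGen g) × Bool)) :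
    (chainOf L).sum (fun _ k => k) = signSum L := by
  induction L with
  | nil => simp [signSum]
  | cons p L ih =>
    rw [chainOf_cons, Finsupp.sum_add_index' (fun _ => rfl) (fun _ _ _ => rfl),
      Finsupp.sum_single_index rfl, ih, signSum_cons]

/-- The traversal chain of `conjProd L`, pointwise, from the face boundaries. [folklore] -/
theorem travF_conjProd_apply (L : List (FreeGroup (surfaceGen g) × Bool)) (e : Edge g) :
    travF 1 (conjProd L) e = (L.map fun p => bsign p.2 * faceB (proj g p.1) e).sum := by
  rw [travF_conjProd]
  induction L with
  | nil => rfl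
  | cons p L ih => rw [map_cons, sum_cons, Finsupp.add_apply, ih, map_cons, sum_cons, Finsupp.smul_apply,
      smul_eq_mul]

open Classical in
/-- The `2`-chain of `conjProd L`, pointwise. [folklore] -/
theorem chainOf_apply (L : List (FreeGroup (surfaceGen g) × Bool)) (F : SurfaceGroup g) :
    chainOf L F = (L.map fun p => if proj g p.1 = F then bsign p.2 else 0).sum := by
  induction L with
  | nil => rfl
  | cons p L ih => rw [chainOf_cons, Finsupp.add_apply, ih, map_cons, sum_cons, Finsupp.single_apply]

/-! ## Pointwise evaluation of traversal chains -/

/-- **A traversal chain vanishes off the traversed edges.** [folklore] -/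
theorem trav_apply_eq_zero_of_forall_ne (v : SurfaceGroup g) (w : List (surfaceGen g × Bool)) (e : Edge g)
    (h : ∀ k (hk : k < w.length), edgeOf (vtx v w k) w[k] ≠ e) : trav v w e = 0 := by
  induction w generalizing v with
  | nil => rfl
  | cons ℓ w ih =>
    rw [trav_cons, Finsupp.add_apply, ih (v * lval ℓ), add_zero, Finsupp.single_eq_of_ne]
    · exact fun he => h 0 (by simp) (by simpa using he.symm)
    · intro k hk
      have := h (k + 1) (by simpa using hk)
      rwa [vtx_cons_succ, getElem_cons_succ] at this

/-- A non-zero value of a traversal chain sits on a traversed edge. [folklore] -/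
theorem exists_edgeOf_eq_of_trav_apply_ne_zero (v : SurfaceGroup g) (w : List (surfaceGen g × Bool))
    (e : Edge g) (h : trav v w e ≠ 0) : ∃ k, ∃ hk : k < w.length, edgeOf (vtx v w k) w[k] = e := by
  by_contra! hne
  exact h (trav_apply_eq_zero_of_forall_ne v w e hne)

/-- A letter whose symbol does not occur contributes nothing at edges with that symbol. [folklore] -/
theorem trav_apply_eq_zero_of_forall_fst_ne (v : SurfaceGroup g) (w : List (surfaceGen g × Bool))
    (e : Edge g) (h : ∀ ℓ ∈ w, ℓ.1 ≠ e.2) : trav v w e = 0 := by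
  refine trav_apply_eq_zero_of_forall_ne v w e fun k hk he => ?_
  exact h _ (getElem_mem hk) (by rw [← he, edgeOf_snd])

/-- **An edge traversed exactly once carries the sign of its letter**: if the traversed edges of
`w` are pairwise distinct, the chain takes the value `±1` on the `k`-th of them. [folklore] -/
theorem trav_apply_edge_of_injective (v : SurfaceGroup g) (w : List (surfaceGen g × Bool))
    (hinj : ∀ k l (hk : k < w.length) (hl : l < w.length),
      edgeOf (vtx v w k) w[k] = edgeOf (vtx v w l) w[l] → k = l)
    {k : ℕ} (hk : k < w.length) : trav v w (edgeOf (vtx v w k) w[k]) = bsign (w[k]).2 := by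
  induction w generalizing v k with
  | nil => simp at hk
  | cons ℓ w ih =>
    have hinj' : ∀ k l (hk : k < w.length) (hl : l < w.length),
        edgeOf (vtx (v * lval ℓ) w k) w[k] = edgeOf (vtx (v * lval ℓ) w l) w[l] → k = l := by
      intro k l hk hl he
      have := hinj (k + 1) (l + 1) (by simpa using hk) (by simpa using hl)
        (by simpa only [vtx_cons_succ, getElem_cons_succ] using he)
      omega
    rcases k with _ | k
    · simp only [vtx_zero, getElem_cons_zero]
      rw [trav_cons, Finsupp.add_apply, Finsupp.single_eq_same, trav_apply_eq_zero_of_forall_ne, add_zero]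
      intro k hk he
      have := hinj (k + 1) 0 (by simpa using hk) (by simp)
        (by simpa only [vtx_cons_succ, getElem_cons_succ, vtx_zero, getElem_cons_zero] using he)
      omega
    · have hk' : k < w.length := by simpa using hk
      simp only [vtx_cons_succ, getElem_cons_succ]
      rw [trav_cons, Finsupp.add_apply, ih (v * lval ℓ) hinj' hk', Finsupp.single_eq_of_ne', zero_add]
      intro he
      have := hinj 0 (k + 1) (by simp) hk
        (by simpa only [vtx_cons_succ, getElem_cons_succ, vtx_zero, getElem_cons_zero] using he)
      omega

end SurfaceGroup

end Literature.Topology.FourManifolds
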